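import Summits.CriticalPhenomena.PercolationContinuityZ3.Theorems.PercNearOneGluingNoHeavyLowerTailSahiCombTriWCompression
import Summits.CriticalPhenomena.PercolationContinuityZ3.Theorems.PercNearOneGluingNoHeavyLowerTailSahiCombTriWGenU

/-!
# `TRI_W(2)`: the ANTI-NESTED stratum reduces to ONE four-chain Hall inequality (AN♯3), by an exact identity

Support file of the one-cut programme (crux `NoHeavyLowerTail`, stmt-CriticalPhenomena-4575; TRI lane of cell `prim-masterthm`; seat prim-lf-1 gen 37,
memo `FROM-prim-lf-1-gen37-ANTINESTED-AND-LOCALITY.md` §2).  Target `FiveUpSet.TriWIneq` (`…SahiCombTriWGeneral`, OPEN for `a ≥ 2`).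

At `a = 2` the index cube is `{∅, {a}, {b}, univ}`; a pair of monotone families is `F ∅ ⊆ F{a}, F{b} ⊆ F univ`, `G` likewise, and
`2·triW = 2·[triWOne(P; F ∅, F univ; G ∅, G univ) + triWOne(P; F{a}, F{b}; G{a}, G{b})]` (`LatticeFiveUpSet.triW_nonneg_of_pair_nonneg`).
The CO-NESTED stratum (`F{b} ⊆ F{a}` and `G{b} ⊆ G{a}`) is `FiveUpSet.triW_nonneg_of_pairwise_nested`.  The **ANTI-NESTED stratum**
(`F{b} ⊆ F{a}` but `G{a} ⊆ G{b}`: both families are 4-CHAINS `F₀ ⊆ F₁ ⊆ F₂ ⊆ F₃`, `G₀ ⊆ G₁ ⊆ G₂ ⊆ G₃` read along OPPOSITE linear extensions of the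
index square; in the orientation language of memo `FROM-prim-masterthm-p5-g21` §7–§8 these are exactly the `a = 2` configurations whose two crossed
orientation components carry opposite signs) is OPEN; it contains exact zeros of `triW`.  This file proves:

* **`FiveUpSet.triWOne_antiNested_eq`** — the EXACT IDENTITY (formal in the 20 atoms `#(P ∩ X ∩ Y)`, `X ∈ {F_i, refl F_i}`, `Y ∈ {G_j, refl G_j}`):
  `triWOne(P;F₀,F₃;G₀,G₃) + triWOne(P;F₂,F₁;G₁,G₂) = [antiNestedSupply − antiNestedDemand] + Kl_{P∩G₁}(F₁) + Kl_{P∩F₁}(G₁) + Kl_{P∩G₀}(F₃)`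
  `+ Σ_{(i,j) ∈ {(0,0),(0,1),(1,0),(2,0),(2,1),(2,2)}} #(P ∩ (F_{i+1} \ F_i) ∩ (G_{j+1} \ G_j))`,
  where `antiNestedDemand = #(P ∩ refl Σ') + #(P∩F₀∩refl G₃) + #(P∩refl F₀∩G₃) + #(P∩F₃∩refl G₀) + #(P∩F₂∩refl G₂) + #(P∩refl F₂∩G₂)`,
  `Σ' = ((F₃\F₀) ∩ (G₃\G₀)) \ ((F₂\F₁) ∩ (G₂\G₁))`, and `antiNestedSupply = #(P∩F₃∩G₃) + #(P∩F₂∩G₃) + #(P∩(F₁∩G₂ ∪ F₂∩G₁)) + #(P∩F₀∩G₂) + #(P∩F₀∩G₀)`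
  (the demand/supply token system "AN♯3" of cell P5 gen 16, `code16/py/an3cert.py`; every other term on the right is a Kleitman gap or a cardinality);
* `FiveUpSet.AntiNestedChainHall` (`@[conjecture]`) — the four-chain Hall inequality `antiNestedDemand ≤ antiNestedSupply` inside every up-set `P`
  (OURS, an obligation of the theory, never a fact).  CENSUS (exact C, this seat, `csrc/an3.c`): EXHAUSTIVE over all `(P, F-chain, G-chain)` for
  `n = 2` (66,150) and `n = 3` (243,602,000 configurations), `3·10⁷` sampled at `n = 4`: 0 violations (437,811 tight cases at `n = 3`); P5 gen 16
  reports 43 rank designs for it proved by its elementary prover (`cprove2`), Lean not written;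
* **`FiveUpSet.pair_nonneg_of_antiNestedChainHall`**, **`FiveUpSet.triW_nonneg_of_antiNested`** — `AntiNestedChainHall ⟹ 0 ≤ triW P F G` on the whole
  anti-nested stratum (identity + three Kleitman inequalities `FiveUpSet.card_inter_refl_le`).
So the anti-nested stratum of `TriWIneq` is EQUIVALENT-IN-PRACTICE to one Hall statement about two nested 4-chains (the bridge that
`…SahiCombFourChainIneq` left open; note AN♯1 = `fourChainIneq_holds` is a DIFFERENT token system and does not imply it termwise: the type-level LP
`kit j158865` with AN♯1 + five-up-set + Kleitman atoms is infeasible).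
HONEST LABEL: one exact identity and a conditional reduction (hypothesis = an OPEN conjecture of ours, census-clean); no new unconditional stratum. [this work]
-/

namespace Summit.CriticalPhenomena.PercolationContinuityZ3.Theorems

namespace FiveUpSet

open Finset LatticeFiveUpSet

variable {γ : Type} [DecidableEq γ] [Fintype γ]

/-- AN♯3 DEMAND count inside `P` for two 4-chains: `#(P ∩ refl Σ') + #(P∩F₀∩refl G₃) + #(P∩refl F₀∩G₃) + #(P∩F₃∩refl G₀) + #(P∩F₂∩refl G₂)
+ #(P∩refl F₂∩G₂)`, `Σ' = ((F₃\F₀) ∩ (G₃\G₀)) \ ((F₂\F₁) ∩ (G₂\G₁))` (cell P5 gen 16, token system AN♯3). [this work] -/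
def antiNestedDemand (P F₀ F₁ F₂ F₃ G₀ G₁ G₂ G₃ : Finset (Finset γ)) : ℕ :=
  (P ∩ refl (((F₃ \ F₀) ∩ (G₃ \ G₀)) \ ((F₂ \ F₁) ∩ (G₂ \ G₁)))).card
    + (P ∩ F₀ ∩ refl G₃).card + (P ∩ refl F₀ ∩ G₃).card + (P ∩ F₃ ∩ refl G₀).card
    + (P ∩ F₂ ∩ refl G₂).card + (P ∩ refl F₂ ∩ G₂).card

/-- AN♯3 SUPPLY count inside `P` (a 5-chain of supply levels `F₃G₃ ⊇ F₂G₃ ⊇ F₁G₂ ∪ F₂G₁ ⊇ F₀G₂ ⊇ F₀G₀`, counted with multiplicity):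
`#(P∩F₃∩G₃) + #(P∩F₂∩G₃) + #(P∩(F₁∩G₂ ∪ F₂∩G₁)) + #(P∩F₀∩G₂) + #(P∩F₀∩G₀)`. [this work] -/
def antiNestedSupply (P F₀ F₁ F₂ F₃ G₀ G₁ G₂ G₃ : Finset (Finset γ)) : ℕ :=
  (P ∩ F₃ ∩ G₃).card + (P ∩ F₂ ∩ G₃).card + (P ∩ (F₁ ∩ G₂ ∪ F₂ ∩ G₁)).card + (P ∩ F₀ ∩ G₂).card + (P ∩ F₀ ∩ G₀).card

/-- **AN♯3 — the four-chain Hall inequality behind the anti-nested stratum of `TRI_W(2)`** (CONJECTURE — an obligation of our theory, never a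
fact): for chains of up-sets `F₀ ⊆ F₁ ⊆ F₂ ⊆ F₃`, `G₀ ⊆ G₁ ⊆ G₂ ⊆ G₃` and every up-set `P` of a finite cube,
`antiNestedDemand P F₀ F₁ F₂ F₃ G₀ G₁ G₂ G₃ ≤ antiNestedSupply P F₀ F₁ F₂ F₃ G₀ G₁ G₂ G₃`.  Equivalently (Hall/Strassen) the six demand token
families admit a cube-upward injection into the five nested supply levels.  CENSUS (prim-lf-1 gen 37, exact): exhaustive `n ≤ 3` (2.4e8
configurations), 3e7 sampled at `n = 4`, 0 violations, many equalities.  By `triW_nonneg_of_antiNested` it implies `TriWIneq` on the anti-nested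
stratum; cell P5 gen 16 found (unformalised) rank certificates for it.  OPEN. [this work] -/
@[conjecture] def AntiNestedChainHall : Prop :=
  ∀ (γ : Type) [DecidableEq γ] [Fintype γ] (P F₀ F₁ F₂ F₃ G₀ G₁ G₂ G₃ : Finset (Finset γ)),
    IsUpperSet (P : Set (Finset γ)) →
    IsUpperSet (F₀ : Set (Finset γ)) → IsUpperSet (F₁ : Set (Finset γ)) → IsUpperSet (F₂ : Set (Finset γ)) → IsUpperSet (F₃ : Set (Finset γ)) →
    IsUpperSet (G₀ : Set (Finset γ)) → IsUpperSet (G₁ : Set (Finset γ)) → IsUpperSet (G₂ : Set (Finset γ)) → IsUpperSet (G₃ : Set (Finset γ)) →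
    F₀ ⊆ F₁ → F₁ ⊆ F₂ → F₂ ⊆ F₃ → G₀ ⊆ G₁ → G₁ ⊆ G₂ → G₂ ⊆ G₃ →
    antiNestedDemand P F₀ F₁ F₂ F₃ G₀ G₁ G₂ G₃ ≤ antiNestedSupply P F₀ F₁ F₂ F₃ G₀ G₁ G₂ G₃

/-! ### Bookkeeping lemmas -/

omit [Fintype γ] in
/-- Cardinality of `P ∩ (X \ Y)` for `Y ⊆ X`: `#(P ∩ (X \ Y)) + #(P ∩ Y) = #(P ∩ X)`. [this work] -/
theorem card_inter_sdiff_add_of_subset (P X Y : Finset (Finset γ)) (h : Y ⊆ X) :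
    (P ∩ (X \ Y)).card + (P ∩ Y).card = (P ∩ X).card := by
  have e : P ∩ (X \ Y) = (P ∩ X) \ (P ∩ Y) := by
    ext s; simp only [mem_inter, mem_sdiff]; tauto
  rw [e]
  exact card_sdiff_add_card_eq_card (inter_subset_inter_left h)

omit [Fintype γ] in
/-- For chains `F₁ ⊆ F₂`, `G₁ ⊆ G₂`: `#(P ∩ (F₁∩G₂ ∪ F₂∩G₁)) + #(P ∩ F₁ ∩ G₁) = #(P ∩ F₁ ∩ G₂) + #(P ∩ F₂ ∩ G₁)`. [this work] -/
theorem card_inter_union_chain (P F₁ F₂ G₁ G₂ : Finset (Finset γ)) (hF : F₁ ⊆ F₂) (hG : G₁ ⊆ G₂) :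
    (P ∩ (F₁ ∩ G₂ ∪ F₂ ∩ G₁)).card + (P ∩ F₁ ∩ G₁).card = (P ∩ F₁ ∩ G₂).card + (P ∩ F₂ ∩ G₁).card := by
  have hu : P ∩ (F₁ ∩ G₂ ∪ F₂ ∩ G₁) = (P ∩ F₁ ∩ G₂) ∪ (P ∩ F₂ ∩ G₁) := by
    ext s; simp only [mem_inter, mem_union]; tauto
  have hi : (P ∩ F₁ ∩ G₂) ∩ (P ∩ F₂ ∩ G₁) = P ∩ F₁ ∩ G₁ := by
    ext s; simp only [mem_inter]
    constructor
    · rintro ⟨⟨⟨hP, hF1⟩, -⟩, ⟨-, hG1⟩⟩; exact ⟨⟨hP, hF1⟩, hG1⟩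
    · rintro ⟨⟨hP, hF1⟩, hG1⟩; exact ⟨⟨⟨hP, hF1⟩, hG hG1⟩, ⟨hP, hF hF1⟩, hG1⟩
  rw [hu, ← hi]
  exact card_union_add_card_inter _ _

/-- The reflected difference-set demand: for chains, `#(P ∩ refl Σ') + [#(P∩rF₂∩rG₂) + #(P∩rF₁∩rG₁) − #(P∩rF₂∩rG₁) − #(P∩rF₁∩rG₂)]`
`= #(P∩rF₃∩rG₃) + #(P∩rF₀∩rG₀) − #(P∩rF₃∩rG₀) − #(P∩rF₀∩rG₃)` (`r = refl`), written additively in `ℕ`. [this work] -/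
theorem card_inter_refl_sigma (P F₀ F₁ F₂ F₃ G₀ G₁ G₂ G₃ : Finset (Finset γ))
    (hF₀₁ : F₀ ⊆ F₁) (hF₁₂ : F₁ ⊆ F₂) (hF₂₃ : F₂ ⊆ F₃) (hG₀₁ : G₀ ⊆ G₁) (hG₁₂ : G₁ ⊆ G₂) (hG₂₃ : G₂ ⊆ G₃) :
    (P ∩ refl (((F₃ \ F₀) ∩ (G₃ \ G₀)) \ ((F₂ \ F₁) ∩ (G₂ \ G₁)))).card
      + (P ∩ refl F₂ ∩ refl G₂).card + (P ∩ refl F₁ ∩ refl G₁).card + (P ∩ refl F₃ ∩ refl G₀).card + (P ∩ refl F₀ ∩ refl G₃).card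
      = (P ∩ refl F₃ ∩ refl G₃).card + (P ∩ refl F₀ ∩ refl G₀).card + (P ∩ refl F₂ ∩ refl G₁).card + (P ∩ refl F₁ ∩ refl G₂).card := by
  -- the small box sits inside the big box
  have hsub : (F₂ \ F₁) ∩ (G₂ \ G₁) ⊆ (F₃ \ F₀) ∩ (G₃ \ G₀) := by
    intro s hs
    simp only [mem_inter, mem_sdiff] at hs ⊢
    exact ⟨⟨hF₂₃ hs.1.1, fun h0 => hs.1.2 (hF₀₁ h0)⟩, ⟨hG₂₃ hs.2.1, fun h0 => hs.2.2 (hG₀₁ h0)⟩⟩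
  have e1 := card_inter_sdiff_add_of_subset P (refl ((F₃ \ F₀) ∩ (G₃ \ G₀))) (refl ((F₂ \ F₁) ∩ (G₂ \ G₁))) (refl_subset_refl hsub)
  rw [← refl_sdiff] at e1
  -- the two reflected boxes, as boxes of the reflected (nested) families
  have t2 : P ∩ refl ((F₂ \ F₁) ∩ (G₂ \ G₁)) = P ∩ (refl F₂ \ refl F₁) ∩ (refl G₂ \ refl G₁) := by
    rw [refl_inter, refl_sdiff, refl_sdiff, inter_assoc]
  have t3 : P ∩ refl ((F₃ \ F₀) ∩ (G₃ \ G₀)) = P ∩ (refl F₃ \ refl F₀) ∩ (refl G₃ \ refl G₀) := by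
    rw [refl_inter, refl_sdiff, refl_sdiff, inter_assoc]
  rw [t2, t3] at e1
  -- expand both boxes with the shell identity
  have big := card_shell_inter_add P (refl F₀) (refl F₃) (refl G₀) (refl G₃)
    (refl_subset_refl (hF₀₁.trans (hF₁₂.trans hF₂₃))) (refl_subset_refl (hG₀₁.trans (hG₁₂.trans hG₂₃)))
  have small := card_shell_inter_add P (refl F₁) (refl F₂) (refl G₁) (refl G₂) (refl_subset_refl hF₁₂) (refl_subset_refl hG₁₂)
  omega

/-! ### The identity -/

/-- **The anti-nested identity.**  For chains `F₀ ⊆ F₁ ⊆ F₂ ⊆ F₃`, `G₀ ⊆ G₁ ⊆ G₂ ⊆ G₃` and any `P`: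
`triWOne(P;F₀,F₃;G₀,G₃) + triWOne(P;F₂,F₁;G₁,G₂) = (antiNestedSupply − antiNestedDemand) + [#(P∩F₁∩G₁) − #(P∩refl F₁∩G₁)] + [#(P∩F₁∩G₁) − #(P∩F₁∩refl G₁)]`
`+ [#(P∩F₃∩G₀) − #(P∩refl F₃∩G₀)] + Σ_{(i,j)∈{00,01,10,20,21,22}} #(P ∩ (F_{i+1}\F_i) ∩ (G_{j+1}\G_j))`.
(Exact; found by fitting, verified as a formal identity in the twenty atoms and exhaustively on `n ≤ 3`.) [this work] -/
theorem triWOne_antiNested_eq (P F₀ F₁ F₂ F₃ G₀ G₁ G₂ G₃ : Finset (Finset γ))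
    (hF₀₁ : F₀ ⊆ F₁) (hF₁₂ : F₁ ⊆ F₂) (hF₂₃ : F₂ ⊆ F₃) (hG₀₁ : G₀ ⊆ G₁) (hG₁₂ : G₁ ⊆ G₂) (hG₂₃ : G₂ ⊆ G₃) :
    triWOne (complEquiv γ) P F₀ F₃ G₀ G₃ + triWOne (complEquiv γ) P F₂ F₁ G₁ G₂
      = ((antiNestedSupply P F₀ F₁ F₂ F₃ G₀ G₁ G₂ G₃ : ℤ) - antiNestedDemand P F₀ F₁ F₂ F₃ G₀ G₁ G₂ G₃)
        + (((P ∩ F₁ ∩ G₁).card : ℤ) - (P ∩ refl F₁ ∩ G₁).card)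
        + (((P ∩ F₁ ∩ G₁).card : ℤ) - (P ∩ F₁ ∩ refl G₁).card)
        + (((P ∩ F₃ ∩ G₀).card : ℤ) - (P ∩ refl F₃ ∩ G₀).card)
        + ((P ∩ (F₁ \ F₀) ∩ (G₁ \ G₀)).card + (P ∩ (F₁ \ F₀) ∩ (G₂ \ G₁)).card + (P ∩ (F₂ \ F₁) ∩ (G₁ \ G₀)).card
            + (P ∩ (F₃ \ F₂) ∩ (G₁ \ G₀)).card + (P ∩ (F₃ \ F₂) ∩ (G₂ \ G₁)).card + (P ∩ (F₃ \ F₂) ∩ (G₃ \ G₂)).card : ℕ) := by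
  have hsig := card_inter_refl_sigma P F₀ F₁ F₂ F₃ G₀ G₁ G₂ G₃ hF₀₁ hF₁₂ hF₂₃ hG₀₁ hG₁₂ hG₂₃
  have hun := card_inter_union_chain P F₁ F₂ G₁ G₂ hF₁₂ hG₁₂
  have s00 := card_shell_inter_add P F₀ F₁ G₀ G₁ hF₀₁ hG₀₁
  have s01 := card_shell_inter_add P F₀ F₁ G₁ G₂ hF₀₁ hG₁₂
  have s10 := card_shell_inter_add P F₁ F₂ G₀ G₁ hF₁₂ hG₀₁
  have s20 := card_shell_inter_add P F₂ F₃ G₀ G₁ hF₂₃ hG₀₁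
  have s21 := card_shell_inter_add P F₂ F₃ G₁ G₂ hF₂₃ hG₁₂
  have s22 := card_shell_inter_add P F₂ F₃ G₂ G₃ hF₂₃ hG₂₃
  unfold antiNestedSupply antiNestedDemand triWOne
  simp only [image_complEquiv]
  push_cast
  omega

/-! ### The reduction -/

/-- **Pair form: AN♯3 ⟹ the anti-nested pair sum is non-negative.**  For up-sets `P` and chains of up-sets `F₀ ⊆ F₁ ⊆ F₂ ⊆ F₃`, `G₀ ⊆ G₁ ⊆ G₂ ⊆ G₃`
of a finite cube, `AntiNestedChainHall` gives `0 ≤ triWOne(P;F₀,F₃;G₀,G₃) + triWOne(P;F₂,F₁;G₁,G₂)`.  Proof: the identity `triWOne_antiNested_eq`,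
the hypothesis, three Kleitman inequalities (`card_inter_refl_le` on the up-sets `P ∩ G₁`, `P ∩ F₁`, `P ∩ G₀`) and six non-negative cardinalities.
[this work] -/
theorem pair_nonneg_of_antiNestedChainHall (h : AntiNestedChainHall) (P F₀ F₁ F₂ F₃ G₀ G₁ G₂ G₃ : Finset (Finset γ))
    (hP : IsUpperSet (P : Set (Finset γ)))
    (hF₀ : IsUpperSet (F₀ : Set (Finset γ))) (hF₁ : IsUpperSet (F₁ : Set (Finset γ)))
    (hF₂ : IsUpperSet (F₂ : Set (Finset γ))) (hF₃ : IsUpperSet (F₃ : Set (Finset γ)))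
    (hG₀ : IsUpperSet (G₀ : Set (Finset γ))) (hG₁ : IsUpperSet (G₁ : Set (Finset γ)))
    (hG₂ : IsUpperSet (G₂ : Set (Finset γ))) (hG₃ : IsUpperSet (G₃ : Set (Finset γ)))
    (hF₀₁ : F₀ ⊆ F₁) (hF₁₂ : F₁ ⊆ F₂) (hF₂₃ : F₂ ⊆ F₃) (hG₀₁ : G₀ ⊆ G₁) (hG₁₂ : G₁ ⊆ G₂) (hG₂₃ : G₂ ⊆ G₃) :
    0 ≤ triWOne (complEquiv γ) P F₀ F₃ G₀ G₃ + triWOne (complEquiv γ) P F₂ F₁ G₁ G₂ := by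
  rw [triWOne_antiNested_eq P F₀ F₁ F₂ F₃ G₀ G₁ G₂ G₃ hF₀₁ hF₁₂ hF₂₃ hG₀₁ hG₁₂ hG₂₃]
  have hd := h γ P F₀ F₁ F₂ F₃ G₀ G₁ G₂ G₃ hP hF₀ hF₁ hF₂ hF₃ hG₀ hG₁ hG₂ hG₃ hF₀₁ hF₁₂ hF₂₃ hG₀₁ hG₁₂ hG₂₃
  have hPG₁ : IsUpperSet ((P ∩ G₁ : Finset (Finset γ)) : Set (Finset γ)) := by rw [coe_inter]; exact hP.inter hG₁
  have hPF₁ : IsUpperSet ((P ∩ F₁ : Finset (Finset γ)) : Set (Finset γ)) := by rw [coe_inter]; exact hP.inter hF₁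
  have hPG₀ : IsUpperSet ((P ∩ G₀ : Finset (Finset γ)) : Set (Finset γ)) := by rw [coe_inter]; exact hP.inter hG₀
  have k1 := card_inter_refl_le hPG₁ hF₁
  have k2 := card_inter_refl_le hPF₁ hG₁
  have k3 := card_inter_refl_le hPG₀ hF₃
  have e1 : P ∩ G₁ ∩ refl F₁ = P ∩ refl F₁ ∩ G₁ := inter_right_comm _ _ _
  have e1' : P ∩ G₁ ∩ F₁ = P ∩ F₁ ∩ G₁ := inter_right_comm _ _ _
  have e3 : P ∩ G₀ ∩ refl F₃ = P ∩ refl F₃ ∩ G₀ := inter_right_comm _ _ _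
  have e3' : P ∩ G₀ ∩ F₃ = P ∩ F₃ ∩ G₀ := inter_right_comm _ _ _
  rw [e1, e1'] at k1
  rw [e3, e3'] at k3
  omega

/-- **AN♯3 ⟹ `TRI_W(2) ≥ 0` on the whole ANTI-NESTED stratum.**  Index cube with two atoms `a ≠ b`; an up-set `P`; monotone families of up-sets `F, G`
with `F {b} ⊆ F {a}` and `G {a} ⊆ G {b}` (both families are chains, along opposite linear extensions of the index square).  Then
`AntiNestedChainHall → 0 ≤ triW P F G`.  (The chains are `F ∅ ⊆ F{b} ⊆ F{a} ⊆ F univ` and `G ∅ ⊆ G{a} ⊆ G{b} ⊆ G univ`; pair form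
`pair_nonneg_of_antiNestedChainHall` + `LatticeFiveUpSet.triW_nonneg_of_pair_nonneg`.)  The mirror stratum (`F{a} ⊆ F{b}`, `G{b} ⊆ G{a}`) is the
same statement with `a, b` exchanged. [this work] -/
theorem triW_nonneg_of_antiNested (h : AntiNestedChainHall) {β : Type} [DecidableEq β] [Fintype β] {a b : β} (hab : a ≠ b)
    (hu : (univ : Finset β) = {a, b}) (P : Finset (Finset γ)) (F G : Finset β → Finset (Finset γ))
    (hP : IsUpperSet (P : Set (Finset γ))) (hF : ∀ x, IsUpperSet (F x : Set (Finset γ))) (hG : ∀ x, IsUpperSet (G x : Set (Finset γ)))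
    (hFm : Monotone F) (hGm : Monotone G) (hFba : F {b} ⊆ F {a}) (hGab : G {a} ⊆ G {b}) :
    0 ≤ triW P F G := by
  refine triW_nonneg_of_pair_nonneg hab hu P F G ?_
  exact pair_nonneg_of_antiNestedChainHall h P (F ∅) (F {b}) (F {a}) (F univ) (G ∅) (G {a}) (G {b}) (G univ)
    hP (hF ∅) (hF {b}) (hF {a}) (hF univ) (hG ∅) (hG {a}) (hG {b}) (hG univ)
    (hFm (empty_subset _)) hFba (hFm (subset_univ _)) (hGm (empty_subset _)) hGab (hGm (subset_univ _))

end FiveUpSet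

end Summit.CriticalPhenomena.PercolationContinuityZ3.Theorems
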